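import Literature.Analysis.FluidPDE.FluidComputer.TubeTable
import HarnessLib

/-!
# Kernel run of the tube checker, chunks 30 … 35 (steps 1500 … 1799) (bp3 gen 13)

HONEST FRAMING: low prior, high value-of-information experiment on Tao's machine paradigm; NOT a
claim that NS blows up.

Kernel evaluations (`decide +kernel`; no `native_decide`, no extra axioms) of the tube checker
`runTube` of `TubeCheck.lean` (dyadic interval arithmetic `DI` at `P = 60`, `12` Taylor terms,
cube radius `Rt`, read-out level `CLt`) on the chunks `cT 30 … cT 35` of the schedule of
`TubeTable.lean`, each from the recorded boundary state `sT i` to `sT (i+1)` (≈ 0.6 s of kernel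
time per step).
-/

namespace Literature.Analysis.FluidPDE.FluidComputer

namespace TubeTable

open ThresholdLevelTable

set_option maxHeartbeats 10000000 in
set_option maxRecDepth 200000 in
/-- Chunk 30 of the tube run (steps 1500 … 1549, `h = 2^-11`). [folklore] -/
theorem run_30 : runTube 60 12 GIt CLt Rt (sT 30) (cT 30) = some (sT (30 + 1)) := by
  decide +kernel

set_option maxHeartbeats 10000000 in
set_option maxRecDepth 200000 in
/-- Chunk 31 of the tube run (steps 1550 … 1599, `h = 2^-11`). [folklore] -/
theorem run_31 : runTube 60 12 GIt CLt Rt (sT 31) (cT 31) = some (sT (31 + 1)) := by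
  decide +kernel

set_option maxHeartbeats 10000000 in
set_option maxRecDepth 200000 in
/-- Chunk 32 of the tube run (steps 1600 … 1649, `h = 2^-11`). [folklore] -/
theorem run_32 : runTube 60 12 GIt CLt Rt (sT 32) (cT 32) = some (sT (32 + 1)) := by
  decide +kernel

set_option maxHeartbeats 10000000 in
set_option maxRecDepth 200000 in
/-- Chunk 33 of the tube run (steps 1650 … 1699, `h = 2^-11`). [folklore] -/
theorem run_33 : runTube 60 12 GIt CLt Rt (sT 33) (cT 33) = some (sT (33 + 1)) := by
  decide +kernel

set_option maxHeartbeats 10000000 in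
set_option maxRecDepth 200000 in
/-- Chunk 34 of the tube run (steps 1700 … 1749, `h = 2^-11`). [folklore] -/
theorem run_34 : runTube 60 12 GIt CLt Rt (sT 34) (cT 34) = some (sT (34 + 1)) := by
  decide +kernel

set_option maxHeartbeats 10000000 in
set_option maxRecDepth 200000 in
/-- Chunk 35 of the tube run (steps 1750 … 1799, `h = 2^-11`). [folklore] -/
theorem run_35 : runTube 60 12 GIt CLt Rt (sT 35) (cT 35) = some (sT (35 + 1)) := by
  decide +kernel

end TubeTable

end Literature.Analysis.FluidPDE.FluidComputer
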